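import Summits.ValiantsHypothesis.ValiantsHypothesis.Theorems.RigidityForcesSymmetryGrenetFirstOrderRankRigidExtraCellPaths
import Summits.ValiantsHypothesis.ValiantsHypothesis.Theorems.RigidityForcesSymmetryGrenetFirstOrderRankRigidBlockIIPermEval

/-!
# Route RigidityForcesSymmetry — `GrenetFirstOrderRankRigid` (item stmt-ValiantsHypothesis-21029),
line `grenet_gauge`: stub `stub_linearRigid`, step 5 (block II) — preliminaries for the extra-cell
designs E2/E3

For the crux line `Cruxes/GrenetFirstOrderRankRigid/Lines/grenet_gauge.lean` (blueprint
`Lines/grenet_gauge-stub_linearRigid-PROOF.md`, §5, block II; NOTES "TYPE II FORMAL PLAN").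
Small set identities used to decide the path conditions at the design points, slices as differences
of prefixes, and the permanent at an extra-cell point (`evalExtra_perPoly`).  No new definitions.
VP ≠ VNP is not moved by this file.
-/

noncomputable section

open MvPolynomial Matrix Finset

namespace Summit.ValiantsHypothesis.Theorems.RigidityForcesSymmetry.GrenetGauge

open Literature.Computability.AlgebraicComplexity

section Sets

variable {α : Type*} [DecidableEq α]

/-- `Disjoint X Z ∧ X ∪ Z = Y ↔ X ⊆ Y ∧ Y \ X = Z`. [folklore] -/
theorem disjoint_and_union_eq_iff {X Z Y : Finset α} :
    (Disjoint X Z ∧ X ∪ Z = Y) ↔ (X ⊆ Y ∧ Y \ X = Z) := by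
  constructor
  · rintro ⟨h1, rfl⟩
    refine ⟨Finset.subset_union_left, ?_⟩
    rw [Finset.union_sdiff_left, Finset.sdiff_eq_self_iff_disjoint]
    exact h1.symm
  · rintro ⟨h1, rfl⟩
    exact ⟨Finset.disjoint_sdiff, Finset.union_sdiff_of_subset h1⟩

/-- Cancelling a disjoint part: `B ∪ X = B ∪ Y ↔ X = Y` for `X, Y` disjoint from `B`. [folklore] -/
theorem union_eq_union_iff_of_disjoint {B X Y : Finset α} (hX : Disjoint B X) (hY : Disjoint B Y) :
    B ∪ X = B ∪ Y ↔ X = Y := by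
  constructor
  · intro h
    ext x
    constructor
    · intro hx
      have : x ∈ B ∪ Y := by rw [← h]; exact Finset.mem_union_right _ hx
      exact (Finset.mem_union.mp this).resolve_left fun hb => Finset.disjoint_left.mp hX hb hx
    · intro hx
      have : x ∈ B ∪ X := by rw [h]; exact Finset.mem_union_right _ hx
      exact (Finset.mem_union.mp this).resolve_left fun hb => Finset.disjoint_left.mp hY hb hx
  · rintro rfl; rfl

/-- `(B ∪ X) - p`, minus `X`, is `B - p` when `B` and `X` are disjoint. [folklore] -/
theorem erase_union_sdiff_of_disjoint {B X : Finset α} (hX : Disjoint B X) (p : α) :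
    (B ∪ X).erase p \ X = B.erase p := by
  ext x
  simp only [Finset.mem_sdiff, Finset.mem_erase, Finset.mem_union]
  constructor
  · rintro ⟨⟨hne, hB | hX'⟩, hnX⟩
    · exact ⟨hne, hB⟩
    · exact absurd hX' hnX
  · rintro ⟨hne, hB⟩
    exact ⟨⟨hne, Or.inl hB⟩, fun hX' => Finset.disjoint_left.mp hX hB hX'⟩

/-- `(B ∪ (T - p)) \ T = B - p` for `p ∈ T` and `B` disjoint from `T - p`. [folklore] -/
theorem union_erase_sdiff_eq {B T : Finset α} {p : α} (hp : p ∈ T) (hX : Disjoint B (T.erase p)) :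
    (B ∪ T.erase p) \ T = B.erase p := by
  ext x
  simp only [Finset.mem_sdiff, Finset.mem_union, Finset.mem_erase, ne_eq]
  constructor
  · rintro ⟨hB | ⟨-, hT⟩, hnT⟩
    · exact ⟨fun h => hnT (h ▸ hp), hB⟩
    · exact absurd hT hnT
  · rintro ⟨hne, hB⟩
    exact ⟨Or.inl hB, fun hT => Finset.disjoint_left.mp hX hB (Finset.mem_erase.mpr ⟨hne, hT⟩)⟩

end Sets

section Extra

variable (k : Type*) [CommRing k] {n : ℕ}

/-- A slice is the difference of two prefixes. [folklore] -/
theorem permSlice_eq_sdiff (π : Equiv.Perm (Fin n)) {s t : ℕ} (hst : s ≤ t) :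
    (univ.filter fun c : Fin n => s ≤ (c : ℕ) ∧ (c : ℕ) < t).image π
      = (univ.filter fun c : Fin n => (c : ℕ) < t).image π \ (univ.filter fun c : Fin n => (c : ℕ) < s).image π := by
  rw [← permSlice_zero π t, ← permSlice_zero π s, ← permSlice_union π (Nat.zero_le s) hst,
    Finset.union_sdiff_left]
  exact (Finset.sdiff_eq_self_iff_disjoint.mpr (permSlice_disjoint π).symm).symm

/-- The letter at position `t - 1` is the difference of the prefixes of lengths `t` and `t - 1`.
[folklore] -/
theorem perm_apply_pred_mem_sdiff (π : Equiv.Perm (Fin n)) {t : ℕ} (ht : 0 < t) (htn : t - 1 < n) :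
    π ⟨t - 1, htn⟩ ∈ (univ.filter fun c : Fin n => (c : ℕ) < t).image π \
      (univ.filter fun c : Fin n => (c : ℕ) < t - 1).image π := by
  rw [Finset.mem_sdiff, Grenet.mem_prefix_image, Grenet.mem_prefix_image, Equiv.symm_apply_apply]
  simp only; omega

/-- The permanent is `1` at an extra-cell point. [folklore] -/
theorem evalExtra_perPoly (π : Equiv.Perm (Fin n)) (c₀ c₁ : Fin n) (hc : c₀ ≠ c₁) :
    eval (fun w : Fin n × Fin n => if π w.2 = w.1 ∨ (w.2 = c₀ ∧ w.1 = π c₁) then (1 : k) else 0)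
      (perPoly (Fin n) k) = 1 := by
  rw [← grenet_W_empty_univ, evalPermExtra_grenet_W k π c₀ c₁ hc ∅ univ (by simp), Finset.card_empty,
    Finset.card_univ, Fintype.card_fin, permSlice_zero]
  have htop : (univ.filter fun c : Fin n => (c : ℕ) < n).image π = univ :=
    Finset.eq_univ_of_forall fun x => (Grenet.mem_prefix_image π n x).mpr (π.symm x).isLt
  rw [if_pos ⟨Finset.disjoint_empty_left _, by rw [Finset.empty_union, htop]⟩, if_neg, add_zero]
  rintro ⟨-, -, h, -⟩
  exact h ⟨Nat.zero_le _, c₁.isLt⟩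

end Extra

end Summit.ValiantsHypothesis.Theorems.RigidityForcesSymmetry.GrenetGauge
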